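import Literature.Analysis.FunctionSpaces.BesselMomentsBoundary
import Mathlib.Analysis.SpecialFunctions.ImproperIntegrals
import Mathlib.MeasureTheory.Integral.Prod
import Mathlib.MeasureTheory.Integral.DominatedConvergence
import HarnessLib

/-!
# Decay of `F = K₀(z)K₀(-z)` and of `G_{n,j} = Fⁿzʲ`; integrability on horizontal lines

Theorem-only sibling of `BesselMomentsKernel.lean` (fifth file towards
`Zhou2017_B3G_sumRule_holds`). With `C₁ = √3√π + 4` and `Cₛ = √3 Γ(1/(4n)) + 4`:

* `‖F(z)‖ ≤ C₁² ‖z‖⁻¹` (`z ≠ 0`) and `‖F(z)‖ ≤ (Cη ‖z‖^{-η})²` for `‖z‖ ≤ 1`;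
* `‖G_{n,j}(z)‖ ≤ C₁^{2n}/‖z‖²` for `‖z‖ ≥ 1`, `j + 2 ≤ n` (this is the `O(|z|^{j-n})` decay that
  makes the contour argument work exactly in Zhou's range `n ≥ 2k ≥ 2`), and
  `‖G_{n,j}(z)‖ ≤ Cₛ^{2n} ‖z‖^{-1/2}` for `0 < ‖z‖ ≤ 1`;
* on a line `Im z = c > 0`: `‖G(x + ic)‖ ≤ (2C₁^{2n} + 2Cₛ^{2n}c^{-1/2})(1 + x²)⁻¹`, so
  `x ↦ G(x + ic)` is continuous and integrable; uniformly in the height,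
  `‖G(x + iδ)‖ ≤ Cₛ^{2n} 𝟙_{[-1,1]}(x)|x|^{-1/2} + 2C₁^{2n}(1 + x²)⁻¹` (`x ≠ 0`), an integrable
  dominator for `δ → 0⁺`; hence `x ↦ G_{n,j}(x)` is integrable on `ℝ` (measurability of `P` as a
  parametric integral; `I₀` continuous, `K₀` measurable likewise).

## References

* [Zhou2017] Y. Zhou, Hilbert transforms and sum rules of Bessel moments, arXiv:1706.01068, §3.1.
-/

noncomputable section

open MeasureTheory Set Filter
open scoped Topology ComplexConjugate

namespace Literature.Analysis.FunctionSpaces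

/-! ### The analytic function `F = P · conj P(-conj ·)` and `G = Fⁿ zʲ` -/

/-- **Decay of `F`**: `‖F z‖ ≤ (√3√π + 4)² ‖z‖⁻¹` (`z ≠ 0`). [folklore] -/
theorem norm_zhouF_le {z : ℂ} (hz : z ≠ 0) :
    ‖zhouF z‖ ≤ (Real.sqrt 3 * Real.sqrt Real.pi + 4) ^ 2 * ‖z‖⁻¹ := by
  have h1 := norm_zhouP_le_rpow_neg_half hz
  have hz' : -conj z ≠ 0 := by simpa using hz
  have h2 := norm_zhouP_le_rpow_neg_half hz'
  rw [norm_neg, Complex.norm_conj] at h2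
  rw [norm_zhouF_eq]
  have hr : ‖z‖ ^ (-(1 / 2) : ℝ) * ‖z‖ ^ (-(1 / 2) : ℝ) = ‖z‖⁻¹ := by
    rw [← Real.rpow_add (norm_pos_iff.2 hz), show (-(1 / 2) : ℝ) + -(1 / 2) = -1 by norm_num,
      Real.rpow_neg_one]
  calc ‖zhouP z‖ * ‖zhouP (-conj z)‖
      ≤ ((Real.sqrt 3 * Real.sqrt Real.pi + 4) * ‖z‖ ^ (-(1 / 2) : ℝ)) *
          ((Real.sqrt 3 * Real.sqrt Real.pi + 4) * ‖z‖ ^ (-(1 / 2) : ℝ)) :=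
        mul_le_mul h1 h2 (norm_nonneg _) (by positivity)
    _ = (Real.sqrt 3 * Real.sqrt Real.pi + 4) ^ 2 * ‖z‖⁻¹ := by rw [← hr]; ring

/-- **`F` near `0`**: `‖F z‖ ≤ (√3 Γ(η) + 4)² ‖z‖^{-2η}` for `0 < ‖z‖ ≤ 1`, `0 < η ≤ 1/2`. [folklore] -/
theorem norm_zhouF_le_small {z : ℂ} (hz : z ≠ 0) (hz1 : ‖z‖ ≤ 1) {η : ℝ} (hη : 0 < η)
    (hη' : η ≤ 1 / 2) :
    ‖zhouF z‖ ≤ ((Real.sqrt 3 * Real.Gamma η + 4) * ‖z‖ ^ (-η)) ^ 2 := by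
  have h1 := norm_zhouP_le_rpow_neg hz hz1 hη hη'
  have hz' : -conj z ≠ 0 := by simpa using hz
  have h2 := norm_zhouP_le_rpow_neg hz' (by simpa using hz1) hη hη'
  rw [norm_neg, Complex.norm_conj] at h2
  rw [norm_zhouF_eq, sq]
  exact mul_le_mul h1 h2 (norm_nonneg _) ((norm_nonneg _).trans h1)

/-- **`G` at infinity**: `‖G_{n,j} z‖ ≤ (√3√π + 4)^{2n} / ‖z‖²` for `‖z‖ ≥ 1`, `j + 2 ≤ n`. [folklore] -/
theorem norm_zhouG_le_large {n j : ℕ} (hn : j + 2 ≤ n) {z : ℂ} (hz : 1 ≤ ‖z‖) :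
    ‖zhouG n j z‖ ≤ (Real.sqrt 3 * Real.sqrt Real.pi + 4) ^ (2 * n) / ‖z‖ ^ 2 := by
  set C : ℝ := Real.sqrt 3 * Real.sqrt Real.pi + 4 with hC
  have hzpos : 0 < ‖z‖ := lt_of_lt_of_le one_pos hz
  have hz0 : z ≠ 0 := norm_pos_iff.1 hzpos
  rw [norm_zhouG_eq]
  have hF := norm_zhouF_le hz0
  calc ‖zhouF z‖ ^ n * ‖z‖ ^ j ≤ (C ^ 2 * ‖z‖⁻¹) ^ n * ‖z‖ ^ j := by
        gcongr
    _ = C ^ (2 * n) * (‖z‖ ^ j / ‖z‖ ^ n) := by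
        rw [mul_pow, ← pow_mul, inv_pow]; ring
    _ ≤ C ^ (2 * n) * (1 / ‖z‖ ^ 2) := by
        refine mul_le_mul_of_nonneg_left ?_ (by positivity)
        rw [div_le_div_iff₀ (by positivity) (by positivity), one_mul, ← pow_add]
        exact pow_le_pow_right₀ hz hn
    _ = C ^ (2 * n) / ‖z‖ ^ 2 := by ring

/-- **`G` near `0`**: `‖G_{n,j} z‖ ≤ (√3 Γ(1/(4n)) + 4)^{2n} ‖z‖^{-1/2}` for `0 < ‖z‖ ≤ 1`, `n ≥ 1`.
[folklore] -/
theorem norm_zhouG_le_small {n j : ℕ} (hn : 1 ≤ n) {z : ℂ} (hz : z ≠ 0) (hz1 : ‖z‖ ≤ 1) :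
    ‖zhouG n j z‖ ≤ (Real.sqrt 3 * Real.Gamma (1 / (4 * n)) + 4) ^ (2 * n) * ‖z‖ ^ (-(1 / 2) : ℝ) := by
  set η : ℝ := 1 / (4 * n) with hη
  have hn' : (1 : ℝ) ≤ n := by exact_mod_cast hn
  have hη0 : 0 < η := by rw [hη]; positivity
  have hη1 : η ≤ 1 / 2 := by
    rw [hη, div_le_div_iff₀ (by positivity) (by norm_num)]
    linarith
  set C : ℝ := Real.sqrt 3 * Real.Gamma η + 4 with hC
  have hC0 : 0 ≤ C := by
    have := Real.Gamma_pos_of_pos hη0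
    positivity
  have hzpos : 0 < ‖z‖ := norm_pos_iff.2 hz
  rw [norm_zhouG_eq]
  have hF := norm_zhouF_le_small hz hz1 hη0 hη1
  have hj : ‖z‖ ^ j ≤ 1 := pow_le_one₀ (norm_nonneg _) hz1
  calc ‖zhouF z‖ ^ n * ‖z‖ ^ j ≤ ((C * ‖z‖ ^ (-η)) ^ 2) ^ n * 1 := by
        gcongr
    _ = C ^ (2 * n) * (‖z‖ ^ (-η)) ^ (2 * n) := by
        rw [← pow_mul, mul_pow, mul_one]
    _ = C ^ (2 * n) * ‖z‖ ^ (-(1 / 2) : ℝ) := by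
        congr 1
        rw [← Real.rpow_natCast, ← Real.rpow_mul hzpos.le]
        congr 1
        rw [hη]
        push_cast
        field_simp
        ring

/-- `‖x + iy‖² = x² + y²`. [folklore] -/
theorem norm_sq_ofReal_add_mul_I (x y : ℝ) : ‖(x : ℂ) + y * Complex.I‖ ^ 2 = x ^ 2 + y ^ 2 := by
  rw [Complex.sq_norm, Complex.normSq_add_mul_I]

/-- **Bound for `G` on a horizontal line** `Im z = c > 0`:
`‖G(x + ic)‖ ≤ (2 C₁^{2n} + 2 Cₛ^{2n} c^{-1/2}) (1 + x²)⁻¹`. [folklore] -/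
theorem norm_zhouG_line_le {n j : ℕ} (hn : j + 2 ≤ n) {c : ℝ} (hc : 0 < c) (x : ℝ) :
    ‖zhouG n j ((x : ℂ) + c * Complex.I)‖ ≤
      (2 * (Real.sqrt 3 * Real.sqrt Real.pi + 4) ^ (2 * n) +
        2 * (Real.sqrt 3 * Real.Gamma (1 / (4 * n)) + 4) ^ (2 * n) * c ^ (-(1 / 2) : ℝ)) *
        (1 + x ^ 2)⁻¹ := by
  set C₁ : ℝ := Real.sqrt 3 * Real.sqrt Real.pi + 4 with hC₁
  set Cs : ℝ := Real.sqrt 3 * Real.Gamma (1 / (4 * n)) + 4 with hCs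
  have hn1 : 1 ≤ n := by omega
  have hCs0 : 0 ≤ Cs := by
    have : 0 < Real.Gamma (1 / (4 * n)) := Real.Gamma_pos_of_pos (by positivity)
    positivity
  set z : ℂ := (x : ℂ) + c * Complex.I with hzdef
  have hz2 : ‖z‖ ^ 2 = x ^ 2 + c ^ 2 := norm_sq_ofReal_add_mul_I x c
  have hzc : c ≤ ‖z‖ := by
    have := Complex.abs_im_le_norm z
    simpa [hzdef, abs_of_pos hc] using this
  have hz0 : z ≠ 0 := norm_pos_iff.1 (hc.trans_le hzc)
  have hx1 : 0 < (1 + x ^ 2)⁻¹ := by positivity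
  have hc2 : 0 ≤ c ^ (-(1 / 2) : ℝ) := Real.rpow_nonneg hc.le _
  rcases le_or_gt 1 ‖z‖ with h1 | h1
  · -- large regime
    have hG := norm_zhouG_le_large hn h1
    have h4 : 1 / ‖z‖ ^ 2 ≤ 2 / (1 + x ^ 2) := by
      rw [div_le_div_iff₀ (by positivity) (by positivity)]
      nlinarith [hz2, h1, norm_nonneg z, sq_nonneg c]
    have h2 : C₁ ^ (2 * n) / ‖z‖ ^ 2 ≤ 2 * C₁ ^ (2 * n) * (1 + x ^ 2)⁻¹ := by
      calc C₁ ^ (2 * n) / ‖z‖ ^ 2 = C₁ ^ (2 * n) * (1 / ‖z‖ ^ 2) := by ring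
        _ ≤ C₁ ^ (2 * n) * (2 / (1 + x ^ 2)) := mul_le_mul_of_nonneg_left h4 (by positivity)
        _ = 2 * C₁ ^ (2 * n) * (1 + x ^ 2)⁻¹ := by ring
    calc ‖zhouG n j z‖ ≤ 2 * C₁ ^ (2 * n) * (1 + x ^ 2)⁻¹ := hG.trans h2
      _ ≤ _ := mul_le_mul_of_nonneg_right (le_add_of_nonneg_right (by positivity)) hx1.le
  · -- small regime
    have hG := norm_zhouG_le_small (j := j) hn1 hz0 h1.le
    have hxlt : x ^ 2 < 1 := by nlinarith [hz2, h1, norm_nonneg z, sq_nonneg c]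
    have h2 : ‖z‖ ^ (-(1 / 2) : ℝ) ≤ c ^ (-(1 / 2) : ℝ) :=
      Real.rpow_le_rpow_of_nonpos hc hzc (by norm_num)
    have h3 : (1 : ℝ) ≤ 2 * (1 + x ^ 2)⁻¹ := by
      rw [show (2 : ℝ) * (1 + x ^ 2)⁻¹ = 2 / (1 + x ^ 2) by ring, le_div_iff₀ (by positivity)]
      linarith
    calc ‖zhouG n j z‖ ≤ Cs ^ (2 * n) * c ^ (-(1 / 2) : ℝ) * 1 := by
          rw [mul_one]; exact hG.trans (mul_le_mul_of_nonneg_left h2 (by positivity))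
      _ ≤ Cs ^ (2 * n) * c ^ (-(1 / 2) : ℝ) * (2 * (1 + x ^ 2)⁻¹) :=
          mul_le_mul_of_nonneg_left h3 (by positivity)
      _ = (2 * Cs ^ (2 * n) * c ^ (-(1 / 2) : ℝ)) * (1 + x ^ 2)⁻¹ := by ring
      _ ≤ _ := mul_le_mul_of_nonneg_right (le_add_of_nonneg_left (by positivity)) hx1.le

/-- **Uniform bound for `G` on the lines `Im z = δ`** (any real `δ`; for dominated convergence as
`δ → 0⁺`): `‖G(x + iδ)‖ ≤ Cₛ^{2n} 𝟙_{[-1,1]}(x)|x|^{-1/2} + 2C₁^{2n}(1 + x²)⁻¹` (`x ≠ 0`).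
[folklore] -/
theorem norm_zhouG_line_le_unif {n j : ℕ} (hn : j + 2 ≤ n) (δ : ℝ) {x : ℝ} (hx : x ≠ 0) :
    ‖zhouG n j ((x : ℂ) + δ * Complex.I)‖ ≤
      (Real.sqrt 3 * Real.Gamma (1 / (4 * n)) + 4) ^ (2 * n) *
          (Icc (-1 : ℝ) 1).indicator (fun x => |x| ^ (-(1 / 2) : ℝ)) x +
        2 * (Real.sqrt 3 * Real.sqrt Real.pi + 4) ^ (2 * n) * (1 + x ^ 2)⁻¹ := by
  set C₁ : ℝ := Real.sqrt 3 * Real.sqrt Real.pi + 4 with hC₁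
  set Cs : ℝ := Real.sqrt 3 * Real.Gamma (1 / (4 * n)) + 4 with hCs
  have hn1 : 1 ≤ n := by omega
  have hCs0 : 0 ≤ Cs := by
    have : 0 < Real.Gamma (1 / (4 * n)) := Real.Gamma_pos_of_pos (by positivity)
    positivity
  set z : ℂ := (x : ℂ) + δ * Complex.I with hzdef
  have hz2 : ‖z‖ ^ 2 = x ^ 2 + δ ^ 2 := norm_sq_ofReal_add_mul_I x δ
  have hzx : |x| ≤ ‖z‖ := by
    have := Complex.abs_re_le_norm z
    simpa [hzdef] using this
  have hxpos : 0 < |x| := abs_pos.2 hx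
  have hz0 : z ≠ 0 := norm_pos_iff.1 (hxpos.trans_le hzx)
  have hind : 0 ≤ (Icc (-1 : ℝ) 1).indicator (fun x => |x| ^ (-(1 / 2) : ℝ)) x := by
    apply Set.indicator_nonneg
    intro y _
    exact Real.rpow_nonneg (abs_nonneg _) _
  rcases le_or_gt 1 ‖z‖ with h1 | h1
  · have hG := norm_zhouG_le_large hn h1
    have h4 : 1 / ‖z‖ ^ 2 ≤ 2 / (1 + x ^ 2) := by
      rw [div_le_div_iff₀ (by positivity) (by positivity)]
      nlinarith [hz2, h1, norm_nonneg z, sq_nonneg δ]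
    have h2 : C₁ ^ (2 * n) / ‖z‖ ^ 2 ≤ 2 * C₁ ^ (2 * n) * (1 + x ^ 2)⁻¹ := by
      calc C₁ ^ (2 * n) / ‖z‖ ^ 2 = C₁ ^ (2 * n) * (1 / ‖z‖ ^ 2) := by ring
        _ ≤ C₁ ^ (2 * n) * (2 / (1 + x ^ 2)) := mul_le_mul_of_nonneg_left h4 (by positivity)
        _ = 2 * C₁ ^ (2 * n) * (1 + x ^ 2)⁻¹ := by ring
    calc ‖zhouG n j z‖ ≤ 2 * C₁ ^ (2 * n) * (1 + x ^ 2)⁻¹ := hG.trans h2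
      _ ≤ _ := le_add_of_nonneg_left (mul_nonneg (pow_nonneg hCs0 _) hind)
  · have hG := norm_zhouG_le_small (j := j) hn1 hz0 h1.le
    have hxI : x ∈ Icc (-1 : ℝ) 1 := by
      have : |x| ≤ 1 := by linarith
      exact ⟨by linarith [neg_abs_le x], by linarith [le_abs_self x]⟩
    rw [Set.indicator_of_mem hxI]
    have h2 : ‖z‖ ^ (-(1 / 2) : ℝ) ≤ |x| ^ (-(1 / 2) : ℝ) :=
      Real.rpow_le_rpow_of_nonpos hxpos hzx (by norm_num)
    calc ‖zhouG n j z‖ ≤ Cs ^ (2 * n) * |x| ^ (-(1 / 2) : ℝ) :=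
          hG.trans (mul_le_mul_of_nonneg_left h2 (by positivity))
      _ ≤ _ := le_add_of_nonneg_right (by positivity)

/-- `|x|^{-1/2}` is integrable on `[-1, 1]`. [folklore] -/
theorem integrableOn_abs_rpow_neg_half : IntegrableOn (fun x : ℝ => |x| ^ (-(1 / 2) : ℝ)) (Icc (-1) 1) := by
  have hr : (-1 : ℝ) < -(1 / 2) := by norm_num
  have base : IntervalIntegrable (fun x : ℝ => x ^ (-(1 / 2) : ℝ)) volume 0 1 :=
    intervalIntegral.intervalIntegrable_rpow' hr
  have hR : IntervalIntegrable (fun x : ℝ => |x| ^ (-(1 / 2) : ℝ)) volume 0 1 := by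
    refine base.congr fun x hx => ?_
    rw [uIoc_of_le zero_le_one] at hx
    show x ^ (-(1 / 2) : ℝ) = |x| ^ (-(1 / 2) : ℝ)
    rw [abs_of_pos hx.1]
  have hL : IntervalIntegrable (fun x : ℝ => |x| ^ (-(1 / 2) : ℝ)) volume (-1) 0 := by
    have h1 : IntervalIntegrable (fun x : ℝ => (-x) ^ (-(1 / 2) : ℝ)) volume (-0) (-1) :=
      (IntervalIntegrable.iff_comp_neg (f := fun x : ℝ => x ^ (-(1 / 2) : ℝ)) (a := 0) (b := 1)
        (by simp)).1 base
    rw [neg_zero] at h1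
    refine (h1.symm).congr fun x hx => ?_
    rw [uIoc_of_le (by norm_num)] at hx
    show (-x) ^ (-(1 / 2) : ℝ) = |x| ^ (-(1 / 2) : ℝ)
    rw [abs_of_nonpos hx.2]
  have h := hL.trans hR
  rw [intervalIntegrable_iff_integrableOn_Icc_of_le (by norm_num)] at h
  exact h

/-- The dominating function of `norm_zhouG_line_le_unif` is integrable on `ℝ`. [folklore] -/
theorem integrable_zhouG_dominator (n : ℕ) :
    Integrable (fun x : ℝ =>
      (Real.sqrt 3 * Real.Gamma (1 / (4 * n)) + 4) ^ (2 * n) *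
          (Icc (-1 : ℝ) 1).indicator (fun x => |x| ^ (-(1 / 2) : ℝ)) x +
        2 * (Real.sqrt 3 * Real.sqrt Real.pi + 4) ^ (2 * n) * (1 + x ^ 2)⁻¹) := by
  refine Integrable.add ?_ (integrable_inv_one_add_sq.const_mul _)
  exact (integrableOn_abs_rpow_neg_half.integrable_indicator measurableSet_Icc).const_mul _

/-- `x ↦ G(x + ic)` is continuous for `c ≠ 0`. [folklore] -/
theorem continuous_zhouG_line (n j : ℕ) {c : ℝ} (hc : c ≠ 0) :
    Continuous fun x : ℝ => zhouG n j ((x : ℂ) + c * Complex.I) := by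
  refine continuous_iff_continuousAt.2 fun x => ?_
  have h1 : Continuous fun x : ℝ => (x : ℂ) + c * Complex.I := by fun_prop
  refine ContinuousAt.comp (g := zhouG n j) (f := fun x : ℝ => (x : ℂ) + c * Complex.I) ?_
    h1.continuousAt
  exact (differentiableAt_zhouG n j (by simpa using hc)).continuousAt

/-- `x ↦ G(x + ic)` is integrable on `ℝ` for `c > 0` (`j + 2 ≤ n`). [folklore] -/
theorem integrable_zhouG_line {n j : ℕ} (hn : j + 2 ≤ n) {c : ℝ} (hc : 0 < c) :
    Integrable fun x : ℝ => zhouG n j ((x : ℂ) + c * Complex.I) := by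
  refine Integrable.mono' (integrable_inv_one_add_sq.const_mul _)
    (continuous_zhouG_line n j hc.ne').aestronglyMeasurable
    (Eventually.of_forall fun x => norm_zhouG_line_le hn hc x)

/-! ### Measurability on the real axis -/

/-- `P` is measurable (a parametric integral of a jointly measurable integrand). [folklore] -/
theorem measurable_zhouP : Measurable zhouP := by
  have h : StronglyMeasurable (Function.uncurry zhouIntegrand) := by
    apply Measurable.stronglyMeasurable
    show Measurable fun p : ℂ × ℝ =>
      ((Real.exp (-p.2) * p.2 ^ (-(1 / 2 : ℝ)) : ℝ) : ℂ) * ((p.2 : ℂ) + 2 * p.1) ^ (((-(1 / 2) : ℝ)) : ℂ)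
    fun_prop
  exact (h.integral_prod_right (ν := volume.restrict (Ioi (0 : ℝ)))).measurable

/-- `G_{n,j}` is measurable. [folklore] -/
theorem measurable_zhouG (n j : ℕ) : Measurable (zhouG n j) := by
  have hc : Measurable (fun z : ℂ => conj z) := Complex.continuous_conj.measurable
  have h1 : Measurable fun z : ℂ => zhouP (-conj z) := measurable_zhouP.comp hc.neg
  have hF : Measurable zhouF := measurable_zhouP.mul (hc.comp h1)
  exact (hF.pow_const n).mul (measurable_id.pow_const j)

/-- `x ↦ G_{n,j}(x)` is integrable on `ℝ` (`j + 2 ≤ n`). [folklore] -/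
theorem integrable_zhouG_real {n j : ℕ} (hn : j + 2 ≤ n) : Integrable fun x : ℝ => zhouG n j x := by
  refine Integrable.mono' (integrable_zhouG_dominator n)
    ((measurable_zhouG n j).comp Complex.continuous_ofReal.measurable).aestronglyMeasurable ?_
  filter_upwards [Measure.ae_ne volume (0 : ℝ)] with x hx
  have h := norm_zhouG_line_le_unif hn 0 hx
  simpa using h

/-- `I_n` is continuous. [folklore] -/
theorem continuous_besselI (n : ℕ) : Continuous (besselI n) := by
  unfold besselI
  refine continuous_const.mul ?_
  have h : Continuous (Function.uncurry fun (x θ : ℝ) => Real.exp (x * Real.cos θ) * Real.cos (n * θ)) := by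
    show Continuous fun p : ℝ × ℝ => Real.exp (p.1 * Real.cos p.2) * Real.cos (n * p.2)
    fun_prop
  exact intervalIntegral.continuous_parametric_intervalIntegral_of_continuous' h 0 Real.pi

/-- `K_ν` (real form) is measurable. [folklore] -/
theorem measurable_besselKReal (nu : ℝ) : Measurable (besselKReal nu) := by
  have h : StronglyMeasurable
      (Function.uncurry fun (x t : ℝ) => Real.exp (-x * Real.cosh t) * Real.cosh (nu * t)) := by
    apply Continuous.stronglyMeasurable
    show Continuous fun p : ℝ × ℝ => Real.exp (-p.1 * Real.cosh p.2) * Real.cosh (nu * p.2)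
    fun_prop
  exact (h.integral_prod_right (ν := volume.restrict (Ioi (0 : ℝ)))).measurable

end Literature.Analysis.FunctionSpaces
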